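import Summits.BirchSwinnertonDyer.Rank1Residual.GaloisImage.LocalH1TorsionBounded
import HarnessLib

/-!
# `H¹(K_v, E[p^{m+1}]) = 0` at a place `v ∤ p` where `E(K_v)[p] = 0`: every local condition at such
# a place is vacuous (THEOREM B of row T-DER at the BAD places `v ∤ p` under the `hloc` certificate)
# (cell `b2b-bsdres`, team n1011, seat p11 GEN 8, OWNERS row T-DER = skel/T-DER.md STATUS v6; file F10)

HONEST FRAMING (cell `b2b-bsdres`, run/shared/lean/b2b/bsd-rank1-residual/, verbatim in every
file): the goal of the cell is to DELETE the COMBINATION-SHAPED residual classes of the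
Birch–Swinnerton-Dyer formula for ALL analytic-rank `≤ 1` elliptic curves over `ℚ` — "full BSD
formula for every rank `≤ 1` curve in class `C`" assembled STRICTLY from published theorems — so
that the rank-`≤ 1` remainder becomes exactly the CONSTRUCTION-SHAPED classes, which are TYPED
(missing-input `Prop`s), NOT attempted. This is not "finishing BSD". Team n1011: research route on
the CONSTRUCTION-SHAPED class X4; no claim beyond the stated classes; nothing is booked. TOOL
theorems (no definition, no named fact, no `sorry`).

## What

For an elliptic curve `E/K` over a number field, a prime `p`, a finite place `v ∤ p` and a level
`m`: the tree's UNCONDITIONAL count `#H¹(K_v, E[p^{m+1}]) = #E(K_v)[p^{m+1}]²` (Tate's local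
Euler–Poincaré characteristic at residue characteristic `≠ p` with `#H⁰ = #H² = #E(K_v)[p^{m+1}]`,
`natCard_galoisCohomology_one_torsion_adicCompletion_eq_sq_of_not_mem`, Milne ADT I Thm. 2.8) gives:
* `card_torsion_pow_eq_one_of_torsion_eq_zero` — `E(K_v)[p] = 0 ⇒ E(K_v)[p^{m+1}] = 0`;
* `subsingleton_galoisCohomology_one_torsion_of_torsion_eq_zero` — **`E(K_v)[p] = 0`, `v ∤ p` ⇒
  `H¹(K_v, E[p^{m+1}]) = 0`**;
* `mem_of_torsion_eq_zero` — hence EVERY class of `H¹(K_v, E[p^{m+1}])` lies in EVERY local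
  condition there (in particular in `𝓕_can(E[p^{m+1}])_v`, in `H¹_ur`, in the transverse condition).
So at a BAD place `v ∤ p` carrying the certificate `E(K_v)[p] = 0` (the cell's `hloc` column,
x11b `LocalTorsion.padicTorsion_eq_zero_of_not_dvd` / n1011-p17/p18's deciders) THEOREM B of row
T-DER ([Rubin00] Thm. 4.5.1 / [MR04] Prop. A.2 — the local condition of Kolyvagin's derivative
classes away from `r p`) holds VACUOUSLY; the good places are F6–F8 (`Derivative.…`); `v ∣ p` is
[MR04] Lemma A.1 (the same certificate at `p`, D7 — not here).

References: J. S. Milne, *Arithmetic Duality Theorems* (2006), Ch. I Thm. 2.8; B. Mazur, K. Rubin,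
Mem. AMS 799 (2004), App. A, Lemma A.1 / Prop. A.2; K. Rubin, *Euler Systems* (2000), Thm. 4.5.1.
-/

noncomputable section

open scoped Classical NumberField

universe u

namespace Summit.BirchSwinnertonDyer.Rank1Residual.GaloisImage

open Field NumberField IsDedekindDomain WeierstrassCurve
open Literature.NumberTheory.EllipticCurves Literature.NumberTheory.GaloisRepresentations
open scoped ContRepresentation

variable {K : Type u} [Field K] [NumberField K] (W : WeierstrassCurve K) [W.IsElliptic]
variable (v : HeightOneSpectrum (𝓞 K)) (p : ℕ) [hp : Fact p.Prime]

omit [W.IsElliptic] hp in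
/-- `E(K_v)[p] = 0 ⇒ E(K_v)[p^{m+1}] = 0` (if `p^{n+1} P = p^n (pP) = 0` then `pP = 0` by induction,
so `P = 0`): the kernel of `p^{m+1}` on `E(K_v)` has one element. [folklore] -/
theorem card_torsion_pow_eq_one_of_torsion_eq_zero
    (htors : ∀ P : (W.baseChange (v.adicCompletion K)).toAffine.Point, p • P = 0 → P = 0) (m : ℕ) :
    Nat.card (nsmulAddMonoidHom (p ^ (m + 1)) :
        (W.baseChange (v.adicCompletion K)).toAffine.Point →+ _).ker = 1 := by
  have hpow : ∀ n : ℕ, ∀ P : (W.baseChange (v.adicCompletion K)).toAffine.Point,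
      p ^ n • P = 0 → P = 0 := by
    intro n
    induction n with
    | zero => intro P hP; simpa using hP
    | succ n ih =>
      intro P hP
      rw [pow_succ, mul_smul] at hP
      exact htors P (ih (p • P) hP)
  rw [Nat.card_eq_one_iff_exists]
  refine ⟨⟨0, by simp⟩, fun P => Subtype.ext ?_⟩
  exact hpow (m + 1) P.1 (by simpa only [AddMonoidHom.mem_ker, nsmulAddMonoidHom_apply] using P.2)

/-- **`H¹(K_v, E[p^{m+1}]) = 0` at `v ∤ p` when `E(K_v)[p] = 0`**: by the tree's unconditional
count `#H¹(K_v, E[p^{m+1}]) = #E(K_v)[p^{m+1}]²` (Tate's local Euler–Poincaré characteristic,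
Milne ADT I Thm. 2.8, `natCard_galoisCohomology_one_torsion_adicCompletion_eq_sq_of_not_mem`) and
`card_torsion_pow_eq_one_of_torsion_eq_zero`. [cite: MilneADT2006, Ch. I §2, Thm. 2.8 (p. 31)] -/
theorem subsingleton_galoisCohomology_one_torsion_of_torsion_eq_zero
    (hpv : ((p : ℕ) : 𝓞 K) ∉ v.asIdeal)
    (htors : ∀ P : (W.baseChange (v.adicCompletion K)).toAffine.Point, p • P = 0 → P = 0) (m : ℕ) :
    Subsingleton (galoisCohomology
      (GaloisRep.restrictField (v.adicCompletion K) (W.torsionGaloisModule (p ^ (m + 1) : ℕ))) 1) := by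
  have hcard := natCard_galoisCohomology_one_torsion_adicCompletion_eq_sq_of_not_mem W v p hpv m
  rw [card_torsion_pow_eq_one_of_torsion_eq_zero W v p htors m, one_pow] at hcard
  exact (Nat.card_eq_one_iff_unique.mp hcard).1

/-- **Every local condition at `v ∤ p` with `E(K_v)[p] = 0` is vacuous**: every class of
`H¹(K_v, E[p^{m+1}])` lies in every additive subgroup (e.g. `𝓕_can,v`, `H¹_ur`, the transverse
condition) — THEOREM B of row T-DER at the bad places under the `hloc` certificate.
[cite: MilneADT2006, Ch. I §2, Thm. 2.8 (p. 31)] -/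
theorem mem_of_torsion_eq_zero (hpv : ((p : ℕ) : 𝓞 K) ∉ v.asIdeal)
    (htors : ∀ P : (W.baseChange (v.adicCompletion K)).toAffine.Point, p • P = 0 → P = 0) (m : ℕ)
    (C : AddSubgroup (galoisCohomology
      (GaloisRep.restrictField (v.adicCompletion K) (W.torsionGaloisModule (p ^ (m + 1) : ℕ))) 1))
    (x : galoisCohomology
      (GaloisRep.restrictField (v.adicCompletion K) (W.torsionGaloisModule (p ^ (m + 1) : ℕ))) 1) :
    x ∈ C := by
  haveI := subsingleton_galoisCohomology_one_torsion_of_torsion_eq_zero W v p hpv htors m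
  rw [Subsingleton.elim x 0]
  exact C.zero_mem

end Summit.BirchSwinnertonDyer.Rank1Residual.GaloisImage

end
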